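import Literature.Analysis.FluidPDE.TaoMainEstimateVorticityAnnulus
import Literature.Analysis.FluidPDE.TaoMainEstimateBackward
import Literature.Analysis.FluidPDE.TaoCarlemanSlab
import Literature.Analysis.FluidPDE.LocalTypeI
import HarnessLib

/-!
# The quiet-shell contradiction: Tao's (5.8)–(5.17) with ZERO final data on the shell
# (item `TerminalTrace.TypeITraceScarL3`, stmt-NavierStokesRegularity-18385; the Q4-assembly of the Carleman
# half `stub_quietShell_noConcentration` of line `annulus-dichotomy`, skeleton v4 — nsreg-p2 g28 ROAD C)

Seat ns-typeII-p3 g10 (cell ns-regularity-ideate), `--supports stmt-NavierStokesRegularity-18385` (helper).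
This file isolates the PURE BOOKKEEPING step of ROUND-26 §1c (Q4), with every analytic input a hypothesis:

* `hAnn` — Tao's annulus lower bound (5.17) (the ∀-part of the tree theorem
  `IsClassicalNSSolutionOn.vorticity_annulus_lower_bound`, constants `Λ₀, K`);
* `hGauss` — the Gaussian lower bound (5.7) at depth for the field `v` with uniform constants `θ, E`
  (the ∀-part of `exists_depth_gaussian_lower_bound`);
* `hconc` — centre enstrophy concentration at every depth (Q1, for `v`);
* `hvcl` — `v` is classical on every late slab `[b − T, b]`, `b < 0`;
* `hshell` — QUIET SHELL: `v, ∇v, ω, ∇ω` bounded by `K'` on `]−δ', 0[ × {R_a ≤ |x| ≤ ΛR_a}` (Q3);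
* `hω0` — the vorticity tends to `0` uniformly on `{2R_a ≤ |x| ≤ ΛR_a/2}` as `t → 0⁻` (Q3 + weak nullity);
* the ratio condition `Λ ≥ Λ₀`, `Λ ≥ 8(2·10¹⁷E/θ + 4√(5·10¹²)/(θκ₀))` (UNIFORM in the class).

Conclusion `false_of_quietShell_concentration : False`.  Proof: with `T₂ = T₂(δ', R_a, K')` small and
`T₁ = T₂/(5·10¹²)`, the concentration at scale `T₁` and `hGauss` (radius `200R_a`) give an
`ε`-INDEPENDENT `ζ₀ ≤ ∫∫_{window × {100R_a<|x|<400R_a}} |ω|²` inside Tao's window `[−ε − T₂/(4·10¹²), −ε]`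
for every `ε ≤ T₁/2`; `hshell` gives (5.10) on `[−ε − T₂, −ε]`; the ratio condition gives
`√T₂ e^{−ΛR_a²/8T₂} ≤ ζ₀`; so `hAnn` at `b = −ε` yields `c* ≤ ∫_{2R_a≤|x|≤ΛR_a/2} |ω(−ε)|²` with `c* > 0`
independent of `ε` — impossible for `ε → 0` by `hω0`.

WHAT THIS IS NOT: not Q1, not Q3, not Stub Q234 itself, not NS regularity — the zero-data squeeze.
[cite: Tao2021QuantitativeNS, Thm. 5.1 proof pp. 38–40 (5.8)–(5.17)]
-/

noncomputable section

set_option linter.dupNamespace false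

namespace Summit.NavierStokesRegularity.NavierStokesRegularity.Theorems.TypeITraceScarL3

open MeasureTheory Set Function Filter Topology Metric
open Literature.Analysis.FluidPDE
open scoped NNReal ENNReal InnerProductSpace RealInnerProductSpace

/-! ### The exponential comparison `√T₂ e^{−ΛR²/8T₂} ≤ ζ₀` -/

/-- The elementary comparison behind the choice of the shell ratio: with `T₁ = T₂/(5·10¹²)`,
`q = R²/T₂ ≥ 1` and `Λ/8 ≥ 2·10¹⁷E/θ + 4√(5·10¹²)/(θκ₀)`, the Gaussian lower bound at depth
`ζ₀ = (θT₁/4)·κ₀T₁^{-1/2}·exp(−E(200R)²/(θT₁))` dominates `√T₂·exp(−ΛR²/(8T₂))`. [folklore] -/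
theorem sqrt_mul_exp_le_gaussianDepth {θ E κ₀ Λ T₂ R : ℝ} (hθ : 0 < θ) (hE : 0 < E) (hκ₀ : 0 < κ₀)
    (hT₂ : 0 < T₂) (hR : 0 < R) (hTR : T₂ ≤ R ^ 2)
    (hΛ : 8 * (2 * 10 ^ 17 * E / θ + 4 * Real.sqrt (5 * 10 ^ 12) / (θ * κ₀)) ≤ Λ) :
    Real.sqrt T₂ * Real.exp (-(Λ * R ^ 2 / (8 * T₂))) ≤
      θ * (T₂ / (5 * 10 ^ 12)) / 4 * (κ₀ * (T₂ / (5 * 10 ^ 12)) ^ (-(1 / 2 : ℝ)) *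
        Real.exp (-(E * (200 * R) ^ 2 / (θ * (T₂ / (5 * 10 ^ 12)))))) := by
  -- abbreviations
  have hN : (0 : ℝ) < 5 * 10 ^ 12 := by norm_num
  set T₁ : ℝ := T₂ / (5 * 10 ^ 12) with hT₁
  have hT₁pos : 0 < T₁ := div_pos hT₂ hN
  set q : ℝ := R ^ 2 / T₂ with hq
  have hq1 : 1 ≤ q := by rw [hq, le_div_iff₀ hT₂, one_mul]; exact hTR
  set c₃ : ℝ := θ * κ₀ / (4 * Real.sqrt (5 * 10 ^ 12)) with hc₃
  have hsN : 0 < Real.sqrt (5 * 10 ^ 12) := Real.sqrt_pos.2 hN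
  have hc₃pos : 0 < c₃ := by rw [hc₃]; positivity
  set c₄ : ℝ := 2 * 10 ^ 17 * E / θ with hc₄
  have hc₄pos : 0 < c₄ := by rw [hc₄]; positivity
  -- the right-hand side equals `c₃ √T₂ e^{−c₄ q}`
  have hsqrtT₁ : Real.sqrt T₁ = Real.sqrt T₂ / Real.sqrt (5 * 10 ^ 12) := by
    rw [hT₁, Real.sqrt_div hT₂.le]
  have hrpow : T₁ * T₁ ^ (-(1 / 2 : ℝ)) = Real.sqrt T₁ := by
    rw [Real.rpow_neg hT₁pos.le, ← Real.sqrt_eq_rpow]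
    have h := Real.mul_self_sqrt hT₁pos.le
    have hs : 0 < Real.sqrt T₁ := Real.sqrt_pos.2 hT₁pos
    field_simp
    linarith [h]
  have hexpArg : E * (200 * R) ^ 2 / (θ * T₁) = c₄ * q := by
    rw [hc₄, hq, hT₁]; field_simp; ring
  have hRHS : θ * T₁ / 4 * (κ₀ * T₁ ^ (-(1 / 2 : ℝ)) * Real.exp (-(E * (200 * R) ^ 2 / (θ * T₁)))) =
      c₃ * Real.sqrt T₂ * Real.exp (-(c₄ * q)) := by
    rw [hexpArg]
    calc θ * T₁ / 4 * (κ₀ * T₁ ^ (-(1 / 2 : ℝ)) * Real.exp (-(c₄ * q)))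
        = θ * κ₀ / 4 * (T₁ * T₁ ^ (-(1 / 2 : ℝ))) * Real.exp (-(c₄ * q)) := by ring
      _ = θ * κ₀ / 4 * Real.sqrt T₁ * Real.exp (-(c₄ * q)) := by rw [hrpow]
      _ = c₃ * Real.sqrt T₂ * Real.exp (-(c₄ * q)) := by rw [hsqrtT₁, hc₃]; field_simp
  rw [hRHS]
  -- the left-hand side is `√T₂ e^{−Λ q/8}`
  have hLHS : Λ * R ^ 2 / (8 * T₂) = Λ / 8 * q := by rw [hq]; field_simp
  rw [hLHS]
  -- `e^{−Λq/8} ≤ e^{−c₄ q} · e^{−q/c₃} ≤ e^{−c₄ q} · c₃`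
  have hΛ8 : c₄ + 1 / c₃ ≤ Λ / 8 := by
    have h1c₃ : 1 / c₃ = 4 * Real.sqrt (5 * 10 ^ 12) / (θ * κ₀) := by rw [hc₃]; field_simp
    rw [h1c₃]
    linarith [hΛ]
  have hsT₂ : 0 < Real.sqrt T₂ := Real.sqrt_pos.2 hT₂
  have hq0 : 0 ≤ q := le_trans zero_le_one hq1
  have hexp1 : Real.exp (-(Λ / 8 * q)) ≤ Real.exp (-(c₄ * q)) * Real.exp (-(q / c₃)) := by
    rw [← Real.exp_add]
    refine Real.exp_le_exp.2 ?_
    have : (c₄ + 1 / c₃) * q ≤ Λ / 8 * q := mul_le_mul_of_nonneg_right hΛ8 hq0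
    have h2 : (c₄ + 1 / c₃) * q = c₄ * q + q / c₃ := by ring
    linarith
  have hexp2 : Real.exp (-(q / c₃)) ≤ c₃ := by
    have h1 : 1 / c₃ ≤ q / c₃ := div_le_div_of_nonneg_right hq1 hc₃pos.le
    calc Real.exp (-(q / c₃)) ≤ Real.exp (-(1 / c₃)) := Real.exp_le_exp.2 (by linarith)
      _ ≤ 1 / (1 / c₃ + 1) := by
          rw [Real.exp_neg, inv_eq_one_div]
          exact one_div_le_one_div_of_le (by positivity) (Real.add_one_le_exp _)
      _ ≤ c₃ := by
          rw [div_le_iff₀ (by positivity)]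
          have : c₃ * (1 / c₃ + 1) = 1 + c₃ := by field_simp
          rw [this]; linarith
  calc Real.sqrt T₂ * Real.exp (-(Λ / 8 * q))
      ≤ Real.sqrt T₂ * (Real.exp (-(c₄ * q)) * Real.exp (-(q / c₃))) :=
        mul_le_mul_of_nonneg_left hexp1 hsT₂.le
    _ ≤ Real.sqrt T₂ * (Real.exp (-(c₄ * q)) * c₃) :=
        mul_le_mul_of_nonneg_left (mul_le_mul_of_nonneg_left hexp2 (Real.exp_pos _).le) hsT₂.le
    _ = c₃ * Real.sqrt T₂ * Real.exp (-(c₄ * q)) := by ring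

/-! ### The zero-data squeeze -/

/-- **The quiet-shell contradiction** (ROUND-26 §1c (Q4); Tao's (5.8)–(5.17) with `Y′ = Y″ = 0`).  See the
module docstring for the meaning of the hypotheses; all constants `Λ₀, K, θ, E, Λ` are class data, while
`δ', R_a, K'` and the field `v` belong to the solution. [cite: Tao2021QuantitativeNS, Thm. 5.1 proof pp. 38–40] -/
theorem false_of_quietShell_concentration
    {Λ₀ K : ℝ}
    (hAnn : ∀ ⦃b T : ℝ⦄ ⦃u : ℝ → EuclideanSpace ℝ (Fin 3) → EuclideanSpace ℝ (Fin 3)⦄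
      ⦃p : ℝ → EuclideanSpace ℝ (Fin 3) → ℝ⦄,
      IsClassicalNSSolutionOn (Icc (b - T) b) 1 0 u p → 0 < T →
      ∀ ⦃Λ R ζ : ℝ⦄, Λ₀ ≤ Λ → 0 < R → T ≤ R ^ 2 →
      (∀ t ∈ Icc (b - T) b, ∀ x : EuclideanSpace ℝ (Fin 3), R ≤ ‖x‖ → ‖x‖ ≤ Λ * R →
        ‖u t x‖ ≤ (Real.sqrt T)⁻¹ ∧ ‖fderiv ℝ (u t) x‖ ≤ T⁻¹ ∧
        ‖vorticity u t x‖ ≤ T⁻¹ ∧ ‖fderiv ℝ (vorticity u t) x‖ ≤ T⁻¹ * (Real.sqrt T)⁻¹) →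
      Real.sqrt T * Real.exp (-(Λ * R ^ 2 / (8 * T))) ≤ ζ →
      ζ ≤ ∫ t in (b - T / 10 ^ 12 / 4)..b,
        ∫ x in ball (0 : EuclideanSpace ℝ (Fin 3)) (400 * R) \ closedBall 0 (100 * R),
          ‖vorticity u t x‖ ^ 2 →
      ζ * T⁻¹ * Real.exp (-(K * Λ ^ 2 * R ^ 2 / T)) ≤
        ∫ x in closedBall (0 : EuclideanSpace ℝ (Fin 3)) (Λ * R / 2) \ ball 0 (2 * R),
          ‖vorticity u b x‖ ^ 2)
    {θ E κ₀ c₂ : ℝ} (hθ : 0 < θ) (hθhalf : θ ≤ 1 / 2) (hE : 0 < E) (hκ₀ : 0 < κ₀)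
    {v : ℝ → EuclideanSpace ℝ (Fin 3) → EuclideanSpace ℝ (Fin 3)}
    (hGauss : ∀ T₁ : ℝ, 0 < T₁ → ∀ t₁ : ℝ, t₁ ≤ -T₁ / 2 →
      (∀ t ∈ Icc (t₁ - c₂ * T₁) t₁,
        κ₀ * T₁ ^ (-(1 / 2 : ℝ)) ≤
          ∫ x in ball (0 : EuclideanSpace ℝ (Fin 3)) (Real.sqrt T₁), ‖curl (v t) x‖ ^ 2) →
      ∀ R : ℝ, Real.sqrt T₁ ≤ R →
        θ * T₁ / 4 * (κ₀ * T₁ ^ (-(1 / 2 : ℝ)) * Real.exp (-(E * R ^ 2 / (θ * T₁)))) ≤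
          ∫ t in (t₁ - θ * T₁ / 4)..t₁,
            ∫ x in ball (0 : EuclideanSpace ℝ (Fin 3)) (2 * R) \ closedBall 0 (R / 2),
              ‖vorticity v t x‖ ^ 2)
    (hconc : ∀ T₁ : ℝ, 0 < T₁ → ∃ t₁ ∈ Icc (-T₁) (-T₁ / 2), ∀ t ∈ Icc (t₁ - c₂ * T₁) t₁,
      κ₀ * T₁ ^ (-(1 / 2 : ℝ)) ≤
        ∫ x in ball (0 : EuclideanSpace ℝ (Fin 3)) (Real.sqrt T₁), ‖curl (v t) x‖ ^ 2)
    (hvcl : ∀ b T : ℝ, b < 0 → 0 < T →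
      ∃ q : ℝ → EuclideanSpace ℝ (Fin 3) → ℝ, IsClassicalNSSolutionOn (Icc (b - T) b) 1 0 v q)
    {Λ : ℝ} (hΛ₀ : Λ₀ ≤ Λ)
    (hΛ : 8 * (2 * 10 ^ 17 * E / θ + 4 * Real.sqrt (5 * 10 ^ 12) / (θ * κ₀)) ≤ Λ)
    {δ' R_a K' : ℝ} (hδ' : 0 < δ') (hR_a : 0 < R_a)
    (hshell : ∀ t ∈ Ioo (-δ') 0, ∀ x : EuclideanSpace ℝ (Fin 3), R_a ≤ ‖x‖ → ‖x‖ ≤ Λ * R_a →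
      ‖v t x‖ ≤ K' ∧ ‖fderiv ℝ (v t) x‖ ≤ K' ∧ ‖vorticity v t x‖ ≤ K' ∧
      ‖fderiv ℝ (vorticity v t) x‖ ≤ K')
    (hω0 : ∀ η : ℝ, 0 < η → ∃ s₀ : ℝ, s₀ < 0 ∧ ∀ s ∈ Ioo s₀ 0, ∀ x : EuclideanSpace ℝ (Fin 3),
      2 * R_a ≤ ‖x‖ → ‖x‖ ≤ Λ * R_a / 2 → ‖vorticity v s x‖ ≤ η) :
    False := by
  -- ### the solution's constants: `K'' ≥ max(K', 1)`, the shell time `T₂`, the depth `T₁`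
  obtain ⟨K'', hK''⟩ : ∃ K'' : ℝ, K'' = |K'| + 1 := ⟨_, rfl⟩
  have hK''1 : 1 ≤ K'' := by rw [hK'']; linarith only [abs_nonneg K']
  have hK''pos : 0 < K'' := by linarith only [hK''1]
  have hK'K'' : K' ≤ K'' := by rw [hK'']; linarith only [le_abs_self K']
  obtain ⟨T₂, hT₂⟩ : ∃ T₂ : ℝ, T₂ = min (δ' / 8) (min (R_a ^ 2) (1 / K'' ^ 2)) := ⟨_, rfl⟩
  have hT₂pos : 0 < T₂ := by rw [hT₂]; exact lt_min (by positivity) (lt_min (by positivity) (by positivity))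
  have hT₂δ : T₂ ≤ δ' / 8 := by rw [hT₂]; exact min_le_left _ _
  have hT₂R : T₂ ≤ R_a ^ 2 := by rw [hT₂]; exact (min_le_right _ _).trans (min_le_left _ _)
  have hT₂K : T₂ ≤ 1 / K'' ^ 2 := by rw [hT₂]; exact (min_le_right _ _).trans (min_le_right _ _)
  obtain ⟨T₁, hT₁⟩ : ∃ T₁ : ℝ, T₁ = T₂ / (5 * 10 ^ 12) := ⟨_, rfl⟩
  have hT₁pos : 0 < T₁ := by rw [hT₁]; positivity
  have hT₁T₂ : 5 * T₁ / 4 = T₂ / 10 ^ 12 / 4 := by rw [hT₁]; ring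
  have hT₁le : 2 * T₁ ≤ T₂ := by
    rw [hT₁, show 2 * (T₂ / (5 * 10 ^ 12)) = T₂ * (2 / (5 * 10 ^ 12)) by ring]
    exact mul_le_of_le_one_right hT₂pos.le (by norm_num)
  -- the depth lower bound `ζ₀` and the positive number `c*`
  obtain ⟨ζ₀, hζ₀⟩ : ∃ ζ₀ : ℝ, ζ₀ = θ * T₁ / 4 * (κ₀ * T₁ ^ (-(1 / 2 : ℝ)) *
      Real.exp (-(E * (200 * R_a) ^ 2 / (θ * T₁)))) := ⟨_, rfl⟩
  have hζ₀pos : 0 < ζ₀ := by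
    rw [hζ₀]
    have : 0 < T₁ ^ (-(1 / 2 : ℝ)) := Real.rpow_pos_of_pos hT₁pos _
    positivity
  obtain ⟨cstar, hcstar⟩ : ∃ cstar : ℝ, cstar = ζ₀ * T₂⁻¹ * Real.exp (-(K * Λ ^ 2 * R_a ^ 2 / T₂)) :=
    ⟨_, rfl⟩
  have hcstarpos : 0 < cstar := by rw [hcstar]; positivity
  -- the top shell and its volume
  have hSvol : volume (closedBall (0 : EuclideanSpace ℝ (Fin 3)) (Λ * R_a / 2) \ ball 0 (2 * R_a)) < ⊤ :=
    (measure_mono Set.sdiff_subset).trans_lt measure_closedBall_lt_top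
  obtain ⟨Vol, hVol⟩ : ∃ Vol : ℝ, Vol = volume.real
      (closedBall (0 : EuclideanSpace ℝ (Fin 3)) (Λ * R_a / 2) \ ball 0 (2 * R_a)) := ⟨_, rfl⟩
  have hVol0 : 0 ≤ Vol := by rw [hVol]; exact measureReal_nonneg
  -- the tolerance `η` with `η² Vol < c*`, the time `s₀` of `hω0`, and the top time `b = −ε`
  obtain ⟨η, hη⟩ : ∃ η : ℝ, η = Real.sqrt (cstar / (2 * (Vol + 1))) := ⟨_, rfl⟩
  have hηpos : 0 < η := by rw [hη]; exact Real.sqrt_pos.2 (by positivity)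
  have hηsq : η ^ 2 * Vol < cstar := by
    rw [hη, Real.sq_sqrt (by positivity)]
    have h1 : cstar / (2 * (Vol + 1)) * Vol ≤ cstar / 2 := by
      rw [div_mul_eq_mul_div, div_le_div_iff₀ (by positivity) (by positivity)]
      linarith only [hcstarpos]
    linarith only [h1, hcstarpos]
  obtain ⟨s₀, hs₀, hsmall⟩ := hω0 η hηpos
  obtain ⟨ε, hε⟩ : ∃ ε : ℝ, ε = min (T₁ / 2) (-s₀ / 2) := ⟨_, rfl⟩
  have hεpos : 0 < ε := by rw [hε]; exact lt_min (by positivity) (by linarith only [hs₀])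
  have hεT₁ : ε ≤ T₁ / 2 := by rw [hε]; exact min_le_left _ _
  have hεs₀ : ε ≤ -s₀ / 2 := by rw [hε]; exact min_le_right _ _
  obtain ⟨b, hb⟩ : ∃ b : ℝ, b = -ε := ⟨_, rfl⟩
  have hbneg : b < 0 := by rw [hb]; linarith only [hεpos]
  have hbs₀ : s₀ < b := by rw [hb]; linarith only [hεs₀, hs₀]
  -- ### `v` is classical on `[b − T₂, b]`
  obtain ⟨p, hcl⟩ := hvcl b T₂ hbneg hT₂pos
  have hab : b - T₂ < b := by linarith only [hT₂pos]
  -- ### (5.10) on the shell over `[b − T₂, b] ⊆ ]−δ', 0[`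
  have hsT₂ : 0 < Real.sqrt T₂ := Real.sqrt_pos.2 hT₂pos
  have hA : K'' ≤ (Real.sqrt T₂)⁻¹ := by
    have h1 : Real.sqrt T₂ ≤ 1 / K'' := by
      calc Real.sqrt T₂ ≤ Real.sqrt (1 / K'' ^ 2) := Real.sqrt_le_sqrt hT₂K
        _ = 1 / K'' := by
            rw [Real.sqrt_div' _ (by positivity : (0 : ℝ) ≤ K'' ^ 2), Real.sqrt_one,
              Real.sqrt_sq hK''pos.le]
    have h2 := inv_anti₀ hsT₂ h1
    rwa [one_div, inv_inv] at h2
  have hB : K'' ≤ T₂⁻¹ := by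
    have h1 : T₂ ≤ 1 / K'' := by
      refine hT₂K.trans ?_
      rw [div_le_div_iff₀ (by positivity) hK''pos]
      nlinarith only [hK''1]
    have h2 := inv_anti₀ hT₂pos h1
    rwa [one_div, inv_inv] at h2
  have hC : K'' ≤ T₂⁻¹ * (Real.sqrt T₂)⁻¹ :=
    hB.trans (le_mul_of_one_le_right (inv_pos.2 hT₂pos).le (hK''1.trans hA))
  have h510 : ∀ t ∈ Icc (b - T₂) b, ∀ x : EuclideanSpace ℝ (Fin 3), R_a ≤ ‖x‖ → ‖x‖ ≤ Λ * R_a →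
      ‖v t x‖ ≤ (Real.sqrt T₂)⁻¹ ∧ ‖fderiv ℝ (v t) x‖ ≤ T₂⁻¹ ∧
      ‖vorticity v t x‖ ≤ T₂⁻¹ ∧ ‖fderiv ℝ (vorticity v t) x‖ ≤ T₂⁻¹ * (Real.sqrt T₂)⁻¹ := by
    intro t ht x hx1 hx2
    have htI : t ∈ Ioo (-δ') 0 := by
      refine ⟨?_, lt_of_le_of_lt ht.2 hbneg⟩
      have : b - T₂ > -δ' := by rw [hb]; linarith only [hεT₁, hT₁le, hT₂δ, hδ']
      linarith only [ht.1, this]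
    obtain ⟨h1, h2, h3, h4⟩ := hshell t htI x hx1 hx2
    exact ⟨h1.trans (hK'K''.trans hA), h2.trans (hK'K''.trans hB), h3.trans (hK'K''.trans hB),
      h4.trans (hK'K''.trans hC)⟩
  -- ### the Gaussian lower bound at depth, inside Tao's window
  obtain ⟨t₁, ht₁, hconc₁⟩ := hconc T₁ hT₁pos
  have hsT₁R : Real.sqrt T₁ ≤ 200 * R_a := by
    have h1 : Real.sqrt T₁ ≤ Real.sqrt (R_a ^ 2) :=
      Real.sqrt_le_sqrt (by linarith only [hT₁le, hT₂R, hT₁pos])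
    rw [Real.sqrt_sq hR_a.le] at h1
    linarith only [h1, hR_a]
  have hG := hGauss T₁ hT₁pos t₁ ht₁.2 hconc₁ (200 * R_a) hsT₁R
  rw [← hζ₀, show 2 * (200 * R_a) = 400 * R_a by ring, show 200 * R_a / 2 = 100 * R_a by ring] at hG
  -- monotonicity in the time window (non-negative continuous integrand on `[b − T₂, b]`)
  have hωc : ContinuousOn (uncurry (vorticity v)) (Icc (b - T₂) b ×ˢ univ) :=
    (hcl.isSmoothSpaceTimeOn_vorticity_Icc hab).continuousOn
  have hΦ : ContinuousOn (fun z : ℝ × EuclideanSpace ℝ (Fin 3) => ‖vorticity v z.1 z.2‖ ^ 2)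
      (Icc (b - T₂ / 10 ^ 12 / 4) b ×ˢ
        closure (ball (0 : EuclideanSpace ℝ (Fin 3)) (400 * R_a) \ closedBall 0 (100 * R_a))) := by
    refine (hωc.norm.pow 2).mono (prod_mono (Icc_subset_Icc ?_ le_rfl) (subset_univ _))
    have h1 : T₂ / 10 ^ 12 ≤ T₂ := div_le_self hT₂pos.le (by norm_num)
    have h2 : T₂ / 10 ^ 12 / 4 ≤ T₂ / 10 ^ 12 := div_le_self (by positivity) (by norm_num)
    exact sub_le_sub_left (h2.trans h1) b
  have hcont : ContinuousOn (fun s => ∫ x in ball (0 : EuclideanSpace ℝ (Fin 3)) (400 * R_a) \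
      closedBall 0 (100 * R_a), ‖vorticity v s x‖ ^ 2) (Icc (b - T₂ / 10 ^ 12 / 4) b) :=
    TaoCarleman.continuousOn_setIntegral_slice (measurableSet_ball.diff measurableSet_closedBall)
      (isBounded_ball.subset Set.sdiff_subset) hΦ
  have hwin : ζ₀ ≤ ∫ t in (b - T₂ / 10 ^ 12 / 4)..b,
      ∫ x in ball (0 : EuclideanSpace ℝ (Fin 3)) (400 * R_a) \ closedBall 0 (100 * R_a),
        ‖vorticity v t x‖ ^ 2 := by
    refine hG.trans (intervalIntegral.integral_mono_interval ?_ ?_ ?_ ?_ ?_)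
    · -- `b − T₂/10¹²/4 = b − 5T₁/4 ≤ t₁ − θT₁/4`
      rw [← hT₁T₂, hb]
      have hθT : θ * T₁ ≤ 1 / 2 * T₁ := mul_le_mul_of_nonneg_right hθhalf hT₁pos.le
      linarith only [ht₁.1, hθT, hεpos, hT₁pos]
    · linarith only [mul_pos hθ hT₁pos]
    · rw [hb]; linarith only [ht₁.2, hεT₁]
    · exact ae_of_all _ fun t => integral_nonneg fun x => by positivity
    · exact hcont.intervalIntegrable_of_Icc (by
        have : 0 ≤ T₂ / 10 ^ 12 / 4 := by positivity
        linarith only [this])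
  -- ### the exponential comparison and Tao's annulus bound at `b`
  have hζ : Real.sqrt T₂ * Real.exp (-(Λ * R_a ^ 2 / (8 * T₂))) ≤ ζ₀ := by
    rw [hζ₀, hT₁]
    exact sqrt_mul_exp_le_gaussianDepth hθ hE hκ₀ hT₂pos hR_a hT₂R hΛ
  have hmain := hAnn hcl hT₂pos hΛ₀ hR_a hT₂R h510 hζ hwin
  rw [← hcstar] at hmain
  -- ### but the vorticity at time `b` is `≤ η` on the shell
  have hle : (∫ x in closedBall (0 : EuclideanSpace ℝ (Fin 3)) (Λ * R_a / 2) \ ball 0 (2 * R_a),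
      ‖vorticity v b x‖ ^ 2) ≤ η ^ 2 * Vol := by
    have h1 := norm_setIntegral_le_of_norm_le_const hSvol
      (f := fun x => ‖vorticity v b x‖ ^ 2) (C := η ^ 2) (fun x hx => by
        rw [Real.norm_of_nonneg (by positivity)]
        have hx1 : 2 * R_a ≤ ‖x‖ := by
          have := hx.2; rw [mem_ball, dist_zero_right, not_lt] at this; exact this
        have hx2 : ‖x‖ ≤ Λ * R_a / 2 := by
          have := hx.1; rw [mem_closedBall, dist_zero_right] at this; exact this
        exact pow_le_pow_left₀ (norm_nonneg _) (hsmall b ⟨hbs₀, hbneg⟩ x hx1 hx2) 2)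
    rw [← hVol, Real.norm_eq_abs] at h1
    exact (le_abs_self _).trans h1
  linarith only [hmain, hle, hηsq]

end Summit.NavierStokesRegularity.NavierStokesRegularity.Theorems.TypeITraceScarL3

end
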